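import Mathlib
import HarnessLib
import Summits.KontsevichZagierPeriods.Zeta5Search.ZudilinVWPBaseCase
import Literature.Analysis.SpecialFunctions.GammaVerticalBounds

/-!
# ζ(5) search — the series of Zudilin's (9) is holomorphic in the parameter `h₁` (cell `pub-zeta5`, ct-1 g26)

HONEST FRAMING: systematic search; no irrationality claim unless kernel-certified.  Estimates and a holomorphy statement
for a series of Gamma values; nothing here is an irrationality result; no named fact of the tree is discharged.

Preparation for removing the Carlson-range restriction of `DougallZudilinForm.zudilin_nine` by analytic continuation in
the parameter `w = h₁ ∈ ℂ` (done in `DougallFullRange`):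
* `summable_fourGamma` — the real four-Gamma term of (9) is summable whenever `x+h₂+h₃ < 1+h₀` (it is
  `O(μ^{2(x+h₂+h₃)−2h₀−3})`, from `DougallCoefficientBounds`);
* `norm_Gamma_add_nat_le` (`‖Γ(w+μ)‖ ≤ Γ(Re w)·(Re w)_μ`, from `GammaVert.norm_Gamma_le_Gamma_re`),
  `norm_inv_Gamma_sub_add_nat_le` (`‖Γ(h₀+1−w+μ)⁻¹‖ ≤ ‖Γ(h₀+1−w)⁻¹‖/(h₀+1−Re w)_μ`);
* `differentiableAt_term`, `differentiableOn_series` — the series of (9) is holomorphic in `w` on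
  `{0 < Re w < 1+h₀−h₂−h₃}` (Weierstrass M-test on small balls against the real four-Gamma term).
Theorems only (no new definitions).
-/

noncomputable section

namespace Summit.KontsevichZagierPeriods.Zeta5Search.DougallParameterHolomorphy

open Finset Filter Set Metric
open Summit.KontsevichZagierPeriods.Zeta5Search.HypergeometricWhipple (rf rf_zero rf_succ)
open Summit.KontsevichZagierPeriods.Zeta5Search.DougallTerminatingGamma (Gamma_add_nat_eq_mul_rf rf_ne_zero)
open Summit.KontsevichZagierPeriods.Zeta5Search.DougallCoefficientBounds (Gamma_add_nat_eq Gamma_ratio_le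
  dougallCoeff_le dougallCoeff_complex)

/-! ### 1. The real four-Gamma term is summable on the full range -/

/-- **Summability of the real four-Gamma term**: for `h₀, x, h₂, h₃ > 0` with `x+h₂+h₃ < 1+h₀`,
`Σ_μ (h₀+2μ)Γ(h₀+μ)Γ(x+μ)Γ(h₂+μ)Γ(h₃+μ)/(Γ(μ+1)Γ(h₀−x+1+μ)Γ(h₀−h₂+1+μ)Γ(h₀−h₃+1+μ)) < ∞` (the term is `O(μ^{2(x+h₂+h₃)−2h₀−3})`). -/
theorem summable_fourGamma (h₀ x h₂ h₃ : ℝ) (hh₀ : 0 < h₀) (hx : 0 < x) (hh₂ : 0 < h₂) (hh₃ : 0 < h₃)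
    (hs : x + h₂ + h₃ < 1 + h₀) :
    Summable fun μ : ℕ => (h₀ + 2 * μ) *
      (Real.Gamma (h₀ + μ) * Real.Gamma (x + μ) * Real.Gamma (h₂ + μ) * Real.Gamma (h₃ + μ)) /
      (Real.Gamma ((μ : ℝ) + 1) * Real.Gamma (h₀ - x + 1 + μ) * Real.Gamma (h₀ - h₂ + 1 + μ) *
        Real.Gamma (h₀ - h₃ + 1 + μ)) := by
  obtain ⟨K, hK⟩ := dougallCoeff_le h₀ h₂ h₃ hh₀ hh₂ hh₃ (by linarith) (by linarith)
  have hp : 2 * (h₂ + h₃) - h₀ - 2 + (x - (h₀ - x + 1)) < -1 := by linarith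
  have hg : Summable fun μ : ℕ => K * 2 ^ (1 + x) * (μ : ℝ) ^ (2 * (h₂ + h₃) - h₀ - 2 + (x - (h₀ - x + 1))) :=
    ((Real.summable_nat_rpow.2 hp).mul_left _)
  refine Summable.of_norm_bounded_eventually_nat hg ?_
  rw [Filter.eventually_atTop]
  refine ⟨⌈max 1 (max h₀ (max h₂ h₃)) + x⌉₊, fun μ hμ => ?_⟩
  have hμ0 : max 1 (max h₀ (max h₂ h₃)) + x ≤ (μ : ℝ) := le_trans (Nat.le_ceil _) (by exact_mod_cast hμ)
  have hm1 : 1 ≤ max 1 (max h₀ (max h₂ h₃)) := le_max_left _ _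
  have hμ' : max 1 (max h₀ (max h₂ h₃)) ≤ (μ : ℝ) := by linarith
  have hμ1 : (1 : ℝ) ≤ μ := by linarith
  have hμx : x ≤ (μ : ℝ) := by linarith
  have hμpos : (0 : ℝ) < μ := by linarith
  have G0 := Real.Gamma_pos_of_pos (show 0 < h₀ + μ by positivity)
  have Gx := Real.Gamma_pos_of_pos (show 0 < x + μ by positivity)
  have G2 := Real.Gamma_pos_of_pos (show 0 < h₂ + μ by positivity)
  have G3 := Real.Gamma_pos_of_pos (show 0 < h₃ + μ by positivity)
  have G1 := Real.Gamma_pos_of_pos (show 0 < (μ : ℝ) + 1 by positivity)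
  have Gx' := Real.Gamma_pos_of_pos (show 0 < h₀ - x + 1 + μ by linarith)
  have G2' := Real.Gamma_pos_of_pos (show 0 < h₀ - h₂ + 1 + μ by linarith)
  have G3' := Real.Gamma_pos_of_pos (show 0 < h₀ - h₃ + 1 + μ by linarith)
  have hnn : 0 ≤ (h₀ + 2 * μ) *
      (Real.Gamma (h₀ + μ) * Real.Gamma (x + μ) * Real.Gamma (h₂ + μ) * Real.Gamma (h₃ + μ)) /
      (Real.Gamma ((μ : ℝ) + 1) * Real.Gamma (h₀ - x + 1 + μ) * Real.Gamma (h₀ - h₂ + 1 + μ) *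
        Real.Gamma (h₀ - h₃ + 1 + μ)) := by positivity
  rw [Real.norm_of_nonneg hnn]
  have e : (h₀ + 2 * μ) *
      (Real.Gamma (h₀ + μ) * Real.Gamma (x + μ) * Real.Gamma (h₂ + μ) * Real.Gamma (h₃ + μ)) /
      (Real.Gamma ((μ : ℝ) + 1) * Real.Gamma (h₀ - x + 1 + μ) * Real.Gamma (h₀ - h₂ + 1 + μ) *
        Real.Gamma (h₀ - h₃ + 1 + μ)) =
      (h₀ + 2 * μ) * (Real.Gamma (h₀ + μ) * Real.Gamma (h₂ + μ) * Real.Gamma (h₃ + μ)) /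
        (Real.Gamma ((μ : ℝ) + 1) * Real.Gamma (h₀ - h₂ + 1 + μ) * Real.Gamma (h₀ - h₃ + 1 + μ)) *
        (Real.Gamma ((μ : ℝ) + x) / Real.Gamma ((μ : ℝ) + (h₀ - x + 1))) := by
    rw [add_comm x (μ : ℝ), show h₀ - x + 1 + (μ : ℝ) = μ + (h₀ - x + 1) by ring]
    field_simp
  rw [e]
  have r := Gamma_ratio_le (a := x) (b := h₀ - x + 1) hμ1 hμx hx.le (by linarith)
  have hA := hK μ hμ'
  have hKnn : 0 ≤ K * (μ : ℝ) ^ (2 * (h₂ + h₃) - h₀ - 2) := le_trans (by positivity) hA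
  calc _ ≤ K * (μ : ℝ) ^ (2 * (h₂ + h₃) - h₀ - 2) * (2 ^ (1 + x) * (μ : ℝ) ^ (x - (h₀ - x + 1))) :=
        mul_le_mul hA r (div_pos (Real.Gamma_pos_of_pos (by positivity))
          (Real.Gamma_pos_of_pos (by linarith))).le hKnn
    _ = K * 2 ^ (1 + x) * (μ : ℝ) ^ (2 * (h₂ + h₃) - h₀ - 2 + (x - (h₀ - x + 1))) := by
        rw [Real.rpow_add hμpos]; ring

/-! ### 2. Termwise bounds in the complex parameter -/

/-- `∏_{i<μ} (Re z + i) ≤ ‖(z)_μ‖` for `Re z ≥ 0`. -/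
theorem prod_re_le_norm_rf (z : ℂ) (hz : 0 ≤ z.re) (μ : ℕ) : ∏ i ∈ range μ, (z.re + i) ≤ ‖rf z μ‖ := by
  unfold rf
  rw [norm_prod]
  refine Finset.prod_le_prod (fun i _ => by positivity) fun i _ => ?_
  calc z.re + i = (z + i).re := by simp
    _ ≤ |(z + i).re| := le_abs_self _
    _ ≤ ‖z + (i : ℂ)‖ := Complex.abs_re_le_norm _

/-- `‖Γ(w+μ)‖ ≤ Γ(Re w) · ∏_{i<μ} (Re w + i)` for `Re w > 0`. -/
theorem norm_Gamma_add_nat_le {w : ℂ} (hw : 0 < w.re) (μ : ℕ) :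
    ‖Complex.Gamma (w + μ)‖ ≤ Real.Gamma w.re * ∏ i ∈ range μ, (w.re + i) := by
  have h := Literature.Analysis.SpecialFunctions.GammaVert.norm_Gamma_le_Gamma_re
    (x := (w + μ).re) (by simp; positivity) ((w + μ).im)
  rw [Complex.re_add_im] at h
  refine h.trans (le_of_eq ?_)
  rw [show (w + (μ : ℂ)).re = w.re + μ by simp, Gamma_add_nat_eq w.re hw μ]

/-- `‖Γ(h₀+1−w+μ)⁻¹‖ ≤ ‖Γ(h₀+1−w)⁻¹‖ / ∏_{i<μ} (h₀+1−Re w+i)` for `Re w < h₀+1`. -/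
theorem norm_inv_Gamma_sub_add_nat_le (h₀ : ℝ) {w : ℂ} (hw : w.re < h₀ + 1) (μ : ℕ) :
    ‖(Complex.Gamma ((h₀ : ℂ) - w + 1 + μ))⁻¹‖ ≤
      ‖(Complex.Gamma ((h₀ : ℂ) - w + 1))⁻¹‖ / ∏ i ∈ range μ, (h₀ - w.re + 1 + i) := by
  have hre : 0 < ((h₀ : ℂ) - w + 1).re := by simp; linarith
  have hne : ∀ n : ℕ, ((h₀ : ℂ) - w + 1) ≠ -(n : ℂ) := by
    intro n h
    have := congrArg Complex.re h
    simp at this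
    linarith [n.cast_nonneg (α := ℝ)]
  have hprod : ∏ i ∈ range μ, (h₀ - w.re + 1 + i) ≤ ‖rf ((h₀ : ℂ) - w + 1) μ‖ := by
    have := prod_re_le_norm_rf ((h₀ : ℂ) - w + 1) hre.le μ
    simpa using this
  have hpos : 0 < ∏ i ∈ range μ, (h₀ - w.re + 1 + i) :=
    Finset.prod_pos fun i _ => by linarith [i.cast_nonneg (α := ℝ)]
  rw [Gamma_add_nat_eq_mul_rf hne μ, mul_inv, norm_mul, norm_inv (rf _ _), ← div_eq_mul_inv]
  exact div_le_div_of_nonneg_left (norm_nonneg _) hpos hprod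

/-! ### 3. Holomorphy of the series in the parameter `w = h₁` -/

/-- Each term of (9) is holomorphic in `w = h₁` on `0 < Re w < h₀+1` (for `h₂, h₃ < h₀+1`). -/
theorem differentiableAt_term (h₀ h₂ h₃ : ℝ) (hh₂ : h₂ < h₀ + 1) (hh₃ : h₃ < h₀ + 1) (μ : ℕ) {w : ℂ}
    (hw : 0 < w.re) (hw' : w.re < h₀ + 1) :
    DifferentiableAt ℂ (fun w : ℂ => ((h₀ : ℂ) + 2 * μ) *
        (Complex.Gamma ((h₀ : ℂ) + μ) * Complex.Gamma (w + μ) * Complex.Gamma ((h₂ : ℂ) + μ) *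
          Complex.Gamma ((h₃ : ℂ) + μ)) /
        (Complex.Gamma ((μ : ℂ) + 1) * Complex.Gamma ((h₀ : ℂ) - w + 1 + μ) * Complex.Gamma ((h₀ : ℂ) - h₂ + 1 + μ) *
          Complex.Gamma ((h₀ : ℂ) - h₃ + 1 + μ))) w := by
  have pole : ∀ {s : ℂ}, 0 < s.re → ∀ m : ℕ, s ≠ -(m : ℂ) := by
    intro s hs m h
    have := congrArg Complex.re h
    simp at this
    linarith [m.cast_nonneg (α := ℝ)]
  have d1 : DifferentiableAt ℂ (fun w : ℂ => Complex.Gamma (w + μ)) w :=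
    (Complex.differentiableAt_Gamma _ (pole (by simp; positivity))).comp w (differentiableAt_id.add_const _)
  have d2 : DifferentiableAt ℂ (fun w : ℂ => Complex.Gamma ((h₀ : ℂ) - w + 1 + μ)) w :=
    (Complex.differentiableAt_Gamma _ (pole (by simp; linarith))).comp w
      ((((differentiableAt_const _).sub differentiableAt_id).add_const _).add_const _)
  refine DifferentiableAt.div ?_ ?_ ?_
  · exact ((((differentiableAt_const _).mul d1).mul_const _).mul_const _).const_mul _
  · exact (((differentiableAt_const _).mul d2).mul_const _).mul_const _
  · have g1 : Complex.Gamma ((μ : ℂ) + 1) ≠ 0 := Complex.Gamma_ne_zero (pole (by simp; positivity))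
    have g2 : Complex.Gamma ((h₀ : ℂ) - w + 1 + μ) ≠ 0 := Complex.Gamma_ne_zero (pole (by simp; linarith))
    have g3 : Complex.Gamma ((h₀ : ℂ) - h₂ + 1 + μ) ≠ 0 :=
      Complex.Gamma_ne_zero (pole (by simp; linarith [μ.cast_nonneg (α := ℝ)]))
    have g4 : Complex.Gamma ((h₀ : ℂ) - h₃ + 1 + μ) ≠ 0 :=
      Complex.Gamma_ne_zero (pole (by simp; linarith [μ.cast_nonneg (α := ℝ)]))
    exact mul_ne_zero (mul_ne_zero (mul_ne_zero g1 g2) g3) g4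

/-- **The series of (9) is holomorphic in `w = h₁`** on `D = {0 < Re w < 1+h₀−h₂−h₃}` (real `h₀, h₂, h₃ > 0`):
locally uniform convergence by the Weierstrass M-test against the real four-Gamma term
(`summable_fourGamma`), using `‖Γ(w+μ)‖ ≤ Γ(Re w+μ)` and `‖(h₀+1−w)_μ‖ ≥ (h₀+1−Re w)_μ`. -/
theorem differentiableOn_series (h₀ h₂ h₃ : ℝ) (hh₀ : 0 < h₀) (hh₂ : 0 < h₂) (hh₃ : 0 < h₃) :
    DifferentiableOn ℂ (fun w : ℂ => ∑' μ : ℕ, ((h₀ : ℂ) + 2 * μ) *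
        (Complex.Gamma ((h₀ : ℂ) + μ) * Complex.Gamma (w + μ) * Complex.Gamma ((h₂ : ℂ) + μ) *
          Complex.Gamma ((h₃ : ℂ) + μ)) /
        (Complex.Gamma ((μ : ℂ) + 1) * Complex.Gamma ((h₀ : ℂ) - w + 1 + μ) * Complex.Gamma ((h₀ : ℂ) - h₂ + 1 + μ) *
          Complex.Gamma ((h₀ : ℂ) - h₃ + 1 + μ)))
      {w : ℂ | 0 < w.re ∧ w.re < 1 + h₀ - h₂ - h₃} := by
  intro w₀ hw₀
  obtain ⟨hx₀, hx₀'⟩ := hw₀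
  -- a ball around `w₀` whose real parts stay in `[xl, xu] ⊂ (0, 1+h₀−h₂−h₃)`
  set δ : ℝ := min (w₀.re / 2) ((1 + h₀ - h₂ - h₃ - w₀.re) / 2) with hδ
  have hδpos : 0 < δ := lt_min (by linarith) (by linarith)
  have hδ1 : δ ≤ w₀.re / 2 := min_le_left _ _
  have hδ2 : δ ≤ (1 + h₀ - h₂ - h₃ - w₀.re) / 2 := min_le_right _ _
  set xl : ℝ := w₀.re - δ with hxl
  set xu : ℝ := w₀.re + δ with hxu
  have hxl0 : 0 < xl := by rw [hxl]; linarith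
  have hxu1 : xu + h₂ + h₃ < 1 + h₀ := by rw [hxu]; linarith
  have hre : ∀ w ∈ ball w₀ δ, xl < w.re ∧ w.re < xu := by
    intro w hw
    rw [mem_ball, dist_eq_norm] at hw
    have h1 := Complex.abs_re_le_norm (w - w₀)
    simp only [Complex.sub_re] at h1
    have h2 := abs_lt.1 (lt_of_le_of_lt h1 hw)
    constructor
    · rw [hxl]; linarith [h2.1]
    · rw [hxu]; linarith [h2.2]
  -- `MΓ` bounds `Γ` on `[xl, xu]`; `Mw` bounds `‖Γ(h₀+1−w)⁻¹‖` on the closed ball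
  obtain ⟨MΓ, hMΓ⟩ : ∃ M : ℝ, ∀ x ∈ Icc xl xu, Real.Gamma x ≤ M := by
    have hc : ContinuousOn Real.Gamma (Icc xl xu) := fun x hx =>
      (Real.differentiableAt_Gamma fun m => by
        have : 0 < x := lt_of_lt_of_le hxl0 hx.1
        intro h; rw [h] at this
        have := m.cast_nonneg (α := ℝ); linarith).continuousAt.continuousWithinAt
    obtain ⟨M, hM⟩ := isCompact_Icc.exists_bound_of_continuousOn hc
    exact ⟨M, fun x hx => (le_abs_self _).trans (by simpa [Real.norm_eq_abs] using hM x hx)⟩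
  have hMΓ0 : 0 ≤ MΓ :=
    (Real.Gamma_pos_of_pos (show 0 < w₀.re from hx₀)).le.trans (hMΓ w₀.re ⟨by rw [hxl]; linarith, by rw [hxu]; linarith⟩)
  obtain ⟨Mw, hMw⟩ : ∃ M : ℝ, ∀ w ∈ closedBall w₀ δ, ‖(Complex.Gamma ((h₀ : ℂ) - w + 1))⁻¹‖ ≤ M := by
    have hd : Differentiable ℂ fun w : ℂ => (h₀ : ℂ) - w + 1 := by fun_prop
    have hc : Continuous fun w : ℂ => (Complex.Gamma ((h₀ : ℂ) - w + 1))⁻¹ :=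
      (Complex.differentiable_one_div_Gamma.comp hd).continuous
    obtain ⟨M, hM⟩ := (isCompact_closedBall w₀ δ).exists_bound_of_continuousOn hc.continuousOn
    exact ⟨M, hM⟩
  have hMw0 : 0 ≤ Mw := (norm_nonneg _).trans (hMw w₀ (mem_closedBall_self hδpos.le))
  -- the majorant
  set A : ℕ → ℝ := fun μ => (h₀ + 2 * μ) * (Real.Gamma (h₀ + μ) * Real.Gamma (h₂ + μ) * Real.Gamma (h₃ + μ)) /
      (Real.Gamma ((μ : ℝ) + 1) * Real.Gamma (h₀ - h₂ + 1 + μ) * Real.Gamma (h₀ - h₃ + 1 + μ)) with hA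
  have hAnn : ∀ μ : ℕ, 0 ≤ A μ := by
    intro μ
    have := Real.Gamma_pos_of_pos (show 0 < h₀ - h₂ + 1 + μ by linarith [μ.cast_nonneg (α := ℝ)])
    have := Real.Gamma_pos_of_pos (show 0 < h₀ - h₃ + 1 + μ by linarith [μ.cast_nonneg (α := ℝ)])
    rw [hA]
    exact div_nonneg (by positivity) (by positivity)
  set u : ℕ → ℝ := fun μ => A μ * ((MΓ * ∏ i ∈ range μ, (xu + i)) *
      (Mw / ∏ i ∈ range μ, (h₀ - xu + 1 + i))) with hu
  have hsum : Summable u := by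
    have h4 := (summable_fourGamma h₀ xu h₂ h₃ hh₀ (by linarith) hh₂ hh₃ (by linarith)).mul_left
      (MΓ * Mw * Real.Gamma (h₀ - xu + 1) / Real.Gamma xu)
    refine h4.congr fun μ => ?_
    have hΓxu : Real.Gamma xu ≠ 0 := (Real.Gamma_pos_of_pos (by linarith)).ne'
    have hΓxu' : Real.Gamma (h₀ - xu + 1) ≠ 0 := (Real.Gamma_pos_of_pos (by linarith)).ne'
    have hP : ∏ i ∈ range μ, (h₀ - xu + 1 + i) ≠ 0 :=
      (Finset.prod_pos fun i _ => by linarith [i.cast_nonneg (α := ℝ)]).ne'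
    rw [hu, hA]
    simp only
    rw [Gamma_add_nat_eq xu (by linarith) μ, Gamma_add_nat_eq (h₀ - xu + 1) (by linarith) μ]
    field_simp
  -- the M-test on the ball
  have hdiff : DifferentiableOn ℂ (fun w : ℂ => ∑' μ : ℕ, ((h₀ : ℂ) + 2 * μ) *
        (Complex.Gamma ((h₀ : ℂ) + μ) * Complex.Gamma (w + μ) * Complex.Gamma ((h₂ : ℂ) + μ) *
          Complex.Gamma ((h₃ : ℂ) + μ)) /
        (Complex.Gamma ((μ : ℂ) + 1) * Complex.Gamma ((h₀ : ℂ) - w + 1 + μ) * Complex.Gamma ((h₀ : ℂ) - h₂ + 1 + μ) *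
          Complex.Gamma ((h₀ : ℂ) - h₃ + 1 + μ))) (ball w₀ δ) := by
    refine Complex.differentiableOn_tsum_of_summable_norm hsum (fun μ w hw => ?_) isOpen_ball (fun μ w hw => ?_)
    · obtain ⟨h1, h2⟩ := hre w hw
      exact (differentiableAt_term h₀ h₂ h₃ (by linarith) (by linarith) μ (by linarith)
        (by linarith)).differentiableWithinAt
    · obtain ⟨h1, h2⟩ := hre w hw
      have hwpos : 0 < w.re := by linarith
      have G2' := Real.Gamma_pos_of_pos (show 0 < h₀ - h₂ + 1 + μ by linarith [μ.cast_nonneg (α := ℝ)])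
      have G3' := Real.Gamma_pos_of_pos (show 0 < h₀ - h₃ + 1 + μ by linarith [μ.cast_nonneg (α := ℝ)])
      -- split off the real coefficient
      have eT : ((h₀ : ℂ) + 2 * μ) *
          (Complex.Gamma ((h₀ : ℂ) + μ) * Complex.Gamma (w + μ) * Complex.Gamma ((h₂ : ℂ) + μ) *
            Complex.Gamma ((h₃ : ℂ) + μ)) /
          (Complex.Gamma ((μ : ℂ) + 1) * Complex.Gamma ((h₀ : ℂ) - w + 1 + μ) * Complex.Gamma ((h₀ : ℂ) - h₂ + 1 + μ) *
            Complex.Gamma ((h₀ : ℂ) - h₃ + 1 + μ)) =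
        (((h₀ : ℂ) + 2 * μ) * (Complex.Gamma ((h₀ : ℂ) + μ) * Complex.Gamma ((h₂ : ℂ) + μ) * Complex.Gamma ((h₃ : ℂ) + μ)) /
          (Complex.Gamma ((μ : ℂ) + 1) * Complex.Gamma ((h₀ : ℂ) - h₂ + 1 + μ) * Complex.Gamma ((h₀ : ℂ) - h₃ + 1 + μ))) *
          (Complex.Gamma (w + μ) * (Complex.Gamma ((h₀ : ℂ) - w + 1 + μ))⁻¹) := by
        rw [div_eq_mul_inv, div_eq_mul_inv]
        ring
      rw [eT, dougallCoeff_complex h₀ h₂ h₃ μ, norm_mul, Complex.norm_real, Real.norm_of_nonneg (hAnn μ), norm_mul]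
      -- the two complex factors
      have b1 : ‖Complex.Gamma (w + μ)‖ ≤ MΓ * ∏ i ∈ range μ, (xu + i) := by
        refine (norm_Gamma_add_nat_le hwpos μ).trans ?_
        refine mul_le_mul (hMΓ w.re ⟨h1.le, h2.le⟩) (Finset.prod_le_prod (fun i _ => by positivity)
          fun i _ => by linarith) (Finset.prod_nonneg fun i _ => by positivity) hMΓ0
      have hPu : 0 < ∏ i ∈ range μ, (h₀ - xu + 1 + i) :=
        Finset.prod_pos fun i _ => by linarith [i.cast_nonneg (α := ℝ)]
      have b2 : ‖(Complex.Gamma ((h₀ : ℂ) - w + 1 + μ))⁻¹‖ ≤ Mw / ∏ i ∈ range μ, (h₀ - xu + 1 + i) := by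
        refine (norm_inv_Gamma_sub_add_nat_le h₀ (by linarith) μ).trans ?_
        exact div_le_div₀ hMw0 (hMw w (ball_subset_closedBall hw)) hPu
          (Finset.prod_le_prod (fun i _ => by linarith [i.cast_nonneg (α := ℝ)]) fun i _ => by linarith)
      rw [hu]
      exact mul_le_mul_of_nonneg_left (mul_le_mul b1 b2 (norm_nonneg _)
        (mul_nonneg hMΓ0 (Finset.prod_nonneg fun i _ => by positivity))) (hAnn μ)
  exact (hdiff.differentiableAt (isOpen_ball.mem_nhds (mem_ball_self hδpos))).differentiableWithinAt

end Summit.KontsevichZagierPeriods.Zeta5Search.DougallParameterHolomorphy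

end
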